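import Summits.FinalStateConjecture.FinalStateConjecture.Theorems.StarvedNecksGapDecaySufficesStubAssemblyDefs
import Summits.FinalStateConjecture.FinalStateConjecture.Theorems.StarvedNecksGapDecaySufficesStubAnchoredLocationP

/-!
# Stub `stub_assembly` (S5 of line `Sketch`, crux `GapDecaySuffices`, skeleton v8) — file 2/2: REDUCTION

This file KERNEL-CHECKS (0 sorries, standard axioms) the registered reduction header of skeleton v8

  `assembly_of_A_B_C : PerHoleRegauge → CertificateBookkeeping → ConcaveDominator →
    (GapBootstrap → FlatFarCertified → SwitchOffInward → AnchoredLocationP → LabelMatching →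
      WeakCertificateAfterRelabelling)`,

i.e. the reduction of the stub `stub_assembly` (S5) to three precisely typed sub-statements

* `PerHoleRegauge`        (A — per-hole re-gauge WITH the parity decision, single-hole clauses K1–K9, K11),
* `CertificateBookkeeping` (B — cross-hole bookkeeping K10/K12 + synchronisation ⇒ `NeckCertificate`),
* `ConcaveDominator`       (C — one-variable lemma: every `o(t)` function is dominated in ratio by a
                            smooth monotone concave sublinear profile of prescribed floor and slope;
                            PROVED as `concaveDominator` in `…StubAssemblyConcaveDominator.lean`, p166564),

whose definitions the skeleton copies verbatim (the skeleton closes its header by `exact` this theorem and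
instantiates C with the landed `concaveDominator`).  The statement bundles (`GapBootstrap`, …,
`WeakCertificateAfterRelabelling`, the v8 `LabelMatching`) and the shapes `GapCert` / `Located` /
`AdmissibleProfile` / `SingleHoleCert` are file 1/2 (`…StubAssemblyDefs.lean`); S4's v8 statement
`AnchoredLocationP` is the landed `…Location.AnchoredP.AnchoredLocationP` (p166857) — its extra hypothesis
"eventually `0 ≤ ρᵢ`" at hole `i` of the relabelled `d'` is discharged by the last conjunct of the v8
`LabelMatching`, and `0 < d'.N` by its clause `d'.N = d.N` (the wave-1 finding that led to v8).

## Design of the cut (why A decides parity, and C is the majorant lemma)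

The parity of hole `i` (sign of `det D(Ψgᵢ⁻¹ ∘ Φ)` on the late collar) can only be read off AFTER the
transition map is known to be `C¹` with invertible differential on the connected collar — the inverse
function theorem for the gap chart, which is the first step of the per-hole re-gauge anyway.  So A takes
the ORIGINAL label and returns a parity datum `P` (landed H1–H4 toolkit: `oneDatum` / `holeDatum`) together
with the re-gauged chart `Ψa` of the RELABELLED label `(Λᵢ P.Q, Ψᵢ ∘ Q̃)`, and the relabelling
`relabelEach d' P` (H4, p146672) with its transfers (`charted`, `Hc`, DV, `Hf`(2)) is done HERE, in the
reduction.  The profile `ρ'` of hole `i` is chosen HERE from C: floor `R₀' + 2 + |aᵢ|`, slope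
`≤ 1/(4γᵢ)`, dominating S4's kinematic majorant `Bkᵢ` and `ρᵢ + 1` in ratio; the gap certificate is
S1's for the majorant `16ρ'` (wall `48ρ' + 2`), and S4 is applied FIVE times (`ρ', 2ρ', …, 16ρ'`, lemma
`located_iterate`) to locate the whole range `[1.1ρ', 46ρ']` of the flat collar in that one certificate —
wide enough to contain the switch-off boxes (hole-time profile `2ρ'(γᵢ t)`) AND the whole certified tube
`{rᵢ < Rcᵢ + 2}` (`Rcᵢ ≈ 9ρ'` at flat time, `≤ 40ρ'`), so that A's injectivity / K7 / K11 and B's K10 /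
K12 never meet an unlocated far flat point of the same hole.

## What B must still prove (lead's warning, made explicit in B's docstring)

K10 (images of different holes' late `Ψa`-tubes disjoint at GROWING radii) and K12 (causal covering) are
not supplied by the structure; B receives EVERYTHING typed (admissible datum, MGHD, `O = exteriorOf`, the
fully honest anchored `d'`, the parity data, per hole: profile, located gap certificate G0–G5, single-hole
certificate with inner/outer location and coverage).  No configuration refuting K10/K12 from these was
found; the delicate sub-claim is "a late far-flat point near hole `j` is not the `Ψgᵢ`-image of a deep
(`rᵢ < 1.1ρ'ᵢ`) point of hole `i ≠ j`" (clopen continuation over G5/`Hf`(2) + cone separation).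
-/

noncomputable section

open scoped Manifold ContDiff Topology ENNReal
open Filter Set Topology Literature.Geometry.Lorentzian

namespace Summit.FinalStateConjecture.FinalStateConjecture.Theorems.GapDecaySuffices.Assembly

-- justified lint debt: the problem namespace repeats the summit name (`FinalStateConjecture.FinalStateConjecture`)
set_option linter.dupNamespace false

open Location.AnchoredV2 (HonestCore HonestFar DistinctVelocities TubeAnchoredR)
open Location.AnchoredP (AnchoredLocationP)
open Relabel (ParityDatum relabelMotion relabelChart relabelEach)

/-! ## The three sub-statements -/

/-- **(A) Per-hole re-gauge with parity decision.**  For a core- and far-honest `C⁴` decomposition with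
distinct velocities, a hole `i`, an admissible profile `ρ'`, a gap certificate of hole `i` above the wall
`3·(16ρ') + 2` (S1 for the majorant `16ρ'`) and the location of the flat collar `[1.1ρ', 46ρ']` in it
(S4 iterated, `located_iterate`), there are a parity datum `P` of `Λᵢ` and data `(τn, Rc, κ', Ψa)`
certifying the `P`-RELABELLED hole (`SingleHoleCert`).  Intended proof (next wave): (1) `k := Ψg⁻¹ ∘ Φ`
on the located collar is smooth with invertible differential (inverse function theorem on `𝒟.carrier`;
`DΨg`, `DΦ` are injective since the certified pullback metrics are non-degenerate), its Jacobian sign is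
constant on the connected late collar: `P := oneDatum` if positive, `holeDatum` (H2, `det = −1`) if not,
so that the rest-frame transition `T = A⁻¹ k A ∘ Q` of the relabelled label has `det DT > 0`;
time-orientation `(DT∂₀)⁰ > 0` from `Hc`(4) + G4; (2) feed `SwitchOffInward` with hole-time profiles
`σ(t) = 2ρ'(γᵢt + cᵢ⁰)`, `rin` from `SlowSmoothMinorant`, `Bm` = rest-frame Kerr–Schild, `h₂` = cut-off
rest-frame `Ψg`-deviation (G3), `h₁` = rest-frame flat deviation (flat `C⁴` certificate, tail sup), the
exact isometry identity being tautological; (3) `Ψa := Ψg_rest ∘ S ∘ A'⁻¹` on `{r < 3.4ρ'}`, `:= Φ` on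
`{r > 3.1ρ'}` (they agree where `S = T`); K4 (local smoothness/openness, injectivity across the seam by
the two locations), K6, K7, inner location and coverage (`Rc(t) := 9ρ'(2γᵢt + C) + R₀ + 4`, clock bounds
`stub_flatTimeGe`), K8/K9 from G3 + the pullback conclusion + `FlatFarCertified`, future lines by continuity of the
time-orientation of the timelike fields `dΨa(Λ∂₀)` along connected slabs from the anchors `S = id` / G4 /
`Hc`(4) (inward of `R₁`: near-zone smallness from G3), K11 from G5 (inner), compactness (middle, `S`
located) and `Hf`(2) (outer). -/
def PerHoleRegauge : Prop :=
  FlatFarCertified → SwitchOffInward →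
  ∀ (𝓢 : Spacetime.{0} 4) (O : Set 𝓢.carrier) (d : FinalStateDecomposition 𝓢 O 4) (R₀ : ℝ) (i : Fin d.N)
    (ρ' : ℝ → ℝ) (τm R₁ τ₁ τ₂ : ℝ) (W κ : ℝ → ℝ) (Ψg : (d.background i).domain → 𝓢.carrier),
    HonestCore 𝓢 O 4 d R₀ → HonestFar 𝓢 O 4 d R₀ → DistinctVelocities 𝓢 O 4 d →
    AdmissibleProfile d R₀ i ρ' τm →
    GapCert d R₀ i (fun s ↦ 3 * (16 * ρ' s) + 2) R₁ τ₁ W Ψg →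
    τ₁ ≤ τ₂ → Tendsto κ atTop (𝓝 0) → Located d i ρ' τ₁ W Ψg τ₂ κ (11 / 10) 46 →
    ∃ (P : ParityDatum (d.motion i).1) (τn : ℝ) (Rc κ' : ℝ → ℝ)
      (Ψa : (boostedKerrBackground (relabelMotion P) (d.motion i).2 (d.mass i) (d.spin i)).domain →
        𝓢.carrier), SingleHoleCert d R₀ i P ρ' τ₁ W Ψg τn Rc κ' Ψa

/-- **(B) Cross-hole bookkeeping.**  For an admissible datum, a maximal development, the exterior `O`, a
FULLY honest radius-anchored `C⁴` decomposition `d` (the output of label matching) with at least one hole,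
parity data `P`, and per hole: an admissible profile, a located gap certificate and a single-hole
certificate of the `P i`-relabelled hole, the relabelled decomposition `relabelEach d P` carries the v5
`NeckCertificate` (with `R₁ := R₀`, `ρa i := ρ' i`, common `τ₁ := max τn` — every single-hole clause is
monotone in its late time).  To be PROVED: K10 — images of different holes' late tubes
`{τ₁ < tᵢ, rᵢ < Rcᵢ + 2}` are disjoint: outer parts are `Φ`-images of coordinate-disjoint late-flat sets
(cone separation p106992, coverage `≤ 40ρ'ᵢ = o(t)`), inner parts are `Ψgᵢ`-images of sub-`5ρ'ᵢ` gap-tube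
points (inner location); the mixed case "`Ψgᵢ(x) = Φ(y)`, `x` deep in hole `i`'s tube, `y` late-flat near
hole `j ≠ i`" is excluded by clopen continuation (coarse surjectivity `stub_clopenSurjection` of the
located transition on the shell `[1.2ρ'ᵢ, 45ρ'ᵢ]`, relative closedness G5 / `Hf`(2), connectedness of the
late far-flat region) — NOT by the structure's fixed-radius `exists_pairwise_disjoint`; K12 — causal
covering of `O` beyond `5ρ'` and the `Ψa`-tubes for every compatible threshold choice: the structure's
covering clause + `Hc`(2) (hole discs) + `Hf`(1) (flat slabs) + future `Λⱼ∂₀`-flows inside certified tubes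
(future-lines clause of the single-hole certificates) + exit arguments in the style of the landed `N = 0` certificate
(`…NecksCertifyStubNeckLedgerAnalysisZero`) and `…SeamedChartsExhaust*`, global hyperbolicity of the MGHD.
If either turned out not to follow for some honest input, that would be a misstatement of the crux's
hinge, to be reported with the configuration. -/
def CertificateBookkeeping : Prop :=
  ∀ (X : Type) [TopologicalSpace X] [ChartedSpace E3 X] [IsManifold (𝓡 3) ∞ X] [ConnectedSpace X]
    (D : InitialDataSet (𝓡 3) X), D ∈ admissibleVacuumData X →
    ∀ 𝒟 : VacuumCauchyDevelopment D, 𝒟.IsMaximal →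
    ∀ (O : Set 𝒟.carrier) (d : FinalStateDecomposition 𝒟.toSpacetime O 4) (R₀ : ℝ),
      O = exteriorOf 𝒟.toCauchyDevelopment d.charted →
      HonestCore 𝒟.toSpacetime O 4 d R₀ → HonestFar 𝒟.toSpacetime O 4 d R₀ →
      DistinctVelocities 𝒟.toSpacetime O 4 d → TubeAnchoredR d R₀ → 0 < d.N →
      ∀ (P : ∀ i, ParityDatum (d.motion i).1) (ρ' : Fin d.N → ℝ → ℝ) (τm R₁ τ₁ τ₂ τn : Fin d.N → ℝ)
        (W κ Rc κ' : Fin d.N → ℝ → ℝ) (Ψg : ∀ i, (d.background i).domain → 𝒟.carrier)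
        (Ψa : ∀ i, (boostedKerrBackground (relabelMotion (P i)) (d.motion i).2 (d.mass i)
          (d.spin i)).domain → 𝒟.carrier),
        (∀ i, AdmissibleProfile d R₀ i (ρ' i) (τm i)) →
        (∀ i, GapCert d R₀ i (fun s ↦ 3 * (16 * ρ' i s) + 2) (R₁ i) (τ₁ i) (W i) (Ψg i)) →
        (∀ i, τ₁ i ≤ τ₂ i ∧ Tendsto (κ i) atTop (𝓝 0) ∧
          Located d i (ρ' i) (τ₁ i) (W i) (Ψg i) (τ₂ i) (κ i) (11 / 10) 46) →
        (∀ i, SingleHoleCert d R₀ i (P i) (ρ' i) (τ₁ i) (W i) (Ψg i) (τn i) (Rc i) (κ' i) (Ψa i)) →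
        NeckCertificate 𝒟.toSpacetime O (relabelEach d P) R₀

/-- **(C) Concave dominator** (one real variable, Mathlib-level): every function `f` with `f(s)/s → 0`
at `+∞` is dominated IN RATIO (`f/ρ → 0`) by a smooth, non-decreasing profile `ρ`, concave on `[0, ∞)`,
sublinear, unbounded, above any prescribed floor `b` and of slope at most any prescribed `ε > 0`.
PROVED (`concaveDominator`, file `…StubAssemblyConcaveDominator.lean`: mollified concave polygon envelope
`⨅ₙ (ε s/(n+1) + cₙ)` of a monotone sublinear majorant of `|f|`). -/
def ConcaveDominator : Prop :=
  ∀ (f : ℝ → ℝ) (b ε : ℝ), Tendsto (fun s ↦ f s / s) atTop (𝓝 0) → 0 < ε →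
    ∃ ρ : ℝ → ℝ, ContDiff ℝ ∞ ρ ∧ Monotone ρ ∧ ConcaveOn ℝ (Set.Ici 0) ρ ∧
      Tendsto (fun s ↦ ρ s / s) atTop (𝓝 0) ∧ Tendsto ρ atTop atTop ∧
      (∀ s, b ≤ ρ s) ∧ (∀ s, |deriv ρ s| ≤ ε) ∧ Tendsto (fun s ↦ f s / ρ s) atTop (𝓝 0)

/-! ## Locating the wide collar: S4 iterated along `ρ', 2ρ', 4ρ', …` -/

section Locate

variable {𝓢 : Spacetime.{0} 4} {O : Set 𝓢.carrier} (d : FinalStateDecomposition 𝓢 O 4) (i : Fin d.N)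
  {τ₁ : ℝ} {W : ℝ → ℝ} {Ψg : (d.background i).domain → 𝓢.carrier}

/-- Weakening a location: later threshold, larger error, narrower window. -/
theorem Located.weaken {ρ' : ℝ → ℝ} {τ₂ τ₂' : ℝ} {κ κ' : ℝ → ℝ} {lo hi hi' : ℝ}
    (h : Located d i ρ' τ₁ W Ψg τ₂ κ lo hi) (hρ : ∀ s, 0 ≤ ρ' s) (hτ : τ₂ ≤ τ₂')
    (hκ : ∀ s, κ s ≤ κ' s) (hhi : hi' ≤ hi) : Located d i ρ' τ₁ W Ψg τ₂' κ' lo hi' := by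
  intro y hy hty hlo hhi'
  obtain ⟨hy', h0, hexc, x, hx1, hx2, hx3, hx4, hx5⟩ :=
    h y hy (lt_of_le_of_lt hτ hty) hlo (hhi'.trans (mul_le_mul_of_nonneg_right hhi (hρ _)))
  have hm : κ ((d.background i).time y) * ρ' (y 0) ≤ κ' ((d.background i).time y) * ρ' (y 0) :=
    mul_le_mul_of_nonneg_right (hκ _) (hρ _)
  exact ⟨hy', h0, hexc, x, hx1, hx2, hx3, hx4.trans hm, hx5.trans hm⟩

/-- Rescaling a location: a window for the profile `c·ρ'` is a window for `ρ'`. -/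
theorem Located.of_mul {ρ' : ℝ → ℝ} {τ₂ : ℝ} {κ : ℝ → ℝ} {lo hi c : ℝ}
    (h : Located d i (fun s ↦ c * ρ' s) τ₁ W Ψg τ₂ κ lo hi) :
    Located d i ρ' τ₁ W Ψg τ₂ (fun s ↦ c * κ s) (lo * c) (hi * c) := by
  intro y hy hty hlo hhi
  obtain ⟨hy', h0, hexc, x, hx1, hx2, hx3, hx4, hx5⟩ :=
    h y hy hty (by simpa only [mul_assoc] using hlo) (by simpa only [mul_assoc] using hhi)
  refine ⟨hy', h0, hexc, x, hx1, hx2, hx3, ?_, ?_⟩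
  · simpa only [mul_assoc, mul_left_comm c] using hx4
  · simpa only [mul_assoc, mul_left_comm c] using hx5

/-- Gluing two overlapping windows of the same profile. -/
theorem Located.glue {ρ' : ℝ → ℝ} {τ₂ τ₂' : ℝ} {κ κ' : ℝ → ℝ} {lo mid mid' hi : ℝ}
    (h₁ : Located d i ρ' τ₁ W Ψg τ₂ κ lo mid') (h₂ : Located d i ρ' τ₁ W Ψg τ₂' κ' mid hi)
    (hρ : ∀ s, 0 ≤ ρ' s) (hmid : mid ≤ mid') :
    Located d i ρ' τ₁ W Ψg (max τ₂ τ₂') (fun s ↦ max (κ s) (κ' s)) lo hi := by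
  intro y hy hty hlo hhi
  rcases le_or_gt ((d.background i).radius y) (mid' * ρ' (y 0)) with hle | hgt
  · exact Located.weaken d i h₁ hρ (le_max_left _ _) (fun s ↦ le_max_left _ _) le_rfl y hy hty hlo hle
  · exact Located.weaken d i h₂ hρ (le_max_right _ _) (fun s ↦ le_max_right _ _) le_rfl y hy hty
      ((mul_le_mul_of_nonneg_right hmid (hρ _)).trans hgt.le) hhi

/-- **S4 iterated**: if S4's location holds at hole `i` for EVERY admissible concave profile dominating
`Bk` (in one fixed gap certificate whose wall is high enough), then for a profile `ρ'` with wall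
`3·2ᵐρ' + 2 ≤ W` the whole window `[1.1ρ', 2.9·2ᵐρ']` is located (apply S4 to `ρ', 2ρ', …, 2ᵐρ'` and
glue the overlapping windows `2.9·2ᵏ ≥ 1.1·2ᵏ⁺¹`). -/
theorem located_iterate (Bk : ℝ → ℝ)
    (hS : ∀ ρ' : ℝ → ℝ, Monotone ρ' → Continuous ρ' → ConcaveOn ℝ (Set.Ici 0) ρ' →
      Tendsto (fun s ↦ ρ' s / s) atTop (𝓝 0) → Tendsto (fun s ↦ Bk s / ρ' s) atTop (𝓝 0) →
      (∀ s, 1 ≤ ρ' s) → (∀ s, τ₁ ≤ s → 3 * ρ' s + 2 ≤ W s) →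
      ∃ (τ₂ : ℝ) (κ : ℝ → ℝ), τ₁ ≤ τ₂ ∧ Tendsto κ atTop (𝓝 0) ∧
        Located d i ρ' τ₁ W Ψg τ₂ κ (11 / 10) (29 / 10)) :
    ∀ (m : ℕ) (ρ' : ℝ → ℝ), Monotone ρ' → Continuous ρ' → ConcaveOn ℝ (Set.Ici 0) ρ' →
      Tendsto (fun s ↦ ρ' s / s) atTop (𝓝 0) → Tendsto (fun s ↦ Bk s / ρ' s) atTop (𝓝 0) →
      (∀ s, 1 ≤ ρ' s) → (∀ s, τ₁ ≤ s → 3 * (2 ^ m * ρ' s) + 2 ≤ W s) →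
      ∃ (τ₂ : ℝ) (κ : ℝ → ℝ), τ₁ ≤ τ₂ ∧ Tendsto κ atTop (𝓝 0) ∧
        Located d i ρ' τ₁ W Ψg τ₂ κ (11 / 10) (29 / 10 * 2 ^ m) := by
  intro m
  induction m with
  | zero =>
    intro ρ' h1 h2 h3 h4 h5 h6 hw
    obtain ⟨τ₂, κ, hτ, hκ, hL⟩ := hS ρ' h1 h2 h3 h4 h5 h6 (fun s hs ↦ by simpa using hw s hs)
    exact ⟨τ₂, κ, hτ, hκ, Located.weaken d i hL (fun s ↦ zero_le_one.trans (h6 s)) le_rfl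
      (fun _ ↦ le_rfl) (by norm_num)⟩
  | succ m ih =>
    intro ρ' h1 h2 h3 h4 h5 h6 hw
    have hρ0 : ∀ s, 0 ≤ ρ' s := fun s ↦ zero_le_one.trans (h6 s)
    have h2m : (1 : ℝ) ≤ 2 ^ (m + 1) := one_le_pow₀ (by norm_num)
    -- the basic window for `ρ'`
    obtain ⟨τ₂, κ, hτ, hκ, hL⟩ := hS ρ' h1 h2 h3 h4 h5 h6 fun s hs ↦ by
      have := hw s hs
      nlinarith [hρ0 s]
    -- the induction hypothesis for `2ρ'`
    obtain ⟨τ₂', κ', hτ', hκ', hL'⟩ := ih (fun s ↦ 2 * ρ' s) (h1.const_mul (by norm_num))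
      (continuous_const.mul h2) (by simpa using h3.smul (show (0 : ℝ) ≤ 2 by norm_num))
      (by simpa [mul_div_assoc] using h4.const_mul 2)
      (by
        have := h5.const_mul (1 / 2)
        rw [mul_zero] at this
        refine this.congr fun s ↦ ?_
        rw [div_mul_eq_div_div_swap, one_div_mul_eq_div])
      (fun s ↦ by linarith [h6 s]) (fun s hs ↦ by rw [pow_succ] at hw; nlinarith [hw s hs])
    refine ⟨max τ₂ τ₂', fun s ↦ max (κ s) (2 * κ' s), le_max_of_le_left hτ, ?_, ?_⟩
    · have := hκ.max (hκ'.const_mul 2)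
      rwa [mul_zero, max_self] at this
    · have hglue := Located.glue d i hL (Located.of_mul d i hL') hρ0 (show 11 / 10 * 2 ≤ (29 / 10 : ℝ) by
        norm_num)
      exact Located.weaken d i hglue hρ0 le_rfl (fun _ ↦ le_rfl) (le_of_eq (by rw [pow_succ]; ring))

end Locate

/-! ## The reduction -/

/-- `Hf`(2) of `d` is `FlatTubesClosed` of the parity-relabelled decomposition (same flat chart, flat
domain, `τ₀`, excisions, radii). -/
theorem flatTubesClosed_relabelEach {𝓢 : Spacetime.{0} 4} {O : Set 𝓢.carrier}
    (d : FinalStateDecomposition 𝓢 O 4) (P : ∀ i, ParityDatum (d.motion i).1) {R₀ : ℝ}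
    (hf : HonestFar 𝓢 O 4 d R₀) : FlatTubesClosed 𝓢 O 4 (relabelEach d P) := by
  intro τ' hτ'
  have e : ∀ i, ((relabelEach d P).background i).radius = (d.background i).radius :=
    fun i ↦ Relabel.relabelEach_radius d P i
  change closure (d.flatChart '' {y : d.flatDomain | τ' ≤ y.1 0 ∧ ∀ i : Fin d.N,
      d.excision i (y.1 0) + 1 ≤ ((relabelEach d P).background i).radius y.1}) ⊆
    d.flatChart '' {y | τ' ≤ y.1 0}
  simp only [e]
  exact hf.2.1 τ' hτ'

set_option maxHeartbeats 1600000 in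
/-- **The reduction of S5** (registered header of skeleton v8, kernel-checked): `stub_assembly` from (A)
per-hole re-gauge, (B) cross-hole bookkeeping and (C) the concave dominator.  Given the input: un-permute
the labels (`LabelMatching` ⟹ honest anchored `d'`, same charted set, `d'.N = d.N`, eventually
non-negative excisions — the last clause discharges the v8 hypothesis of `AnchoredLocationP` at each hole);
per hole `i` of `d'`: S4's kinematic majorant `Bkᵢ`; the profile `ρ'ᵢ` from (C) (floor
`max 1 (R₀' + 2 + |aᵢ|)`, slope `1/(4γᵢ)`, dominating `max |Bkᵢ| (ρᵢ + 1)`); S1's gap certificate of `d'`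
at `i` for the majorant `16ρ'ᵢ`; S4 five times (`located_iterate`, `m = 4`) ⟹ the collar `[1.1ρ'ᵢ, 46ρ'ᵢ]`
is located in it; (A) ⟹ parity datum `Pᵢ` and the single-hole certificate of the relabelled hole; then
`d'' := relabelEach d' P` has the same charted set (H4), `0 < d''.N`, `Hc` / DV / `Hf`(2) transferred
(H4), and (B) gives its `NeckCertificate`. -/
theorem assembly_of_A_B_C : PerHoleRegauge → CertificateBookkeeping → ConcaveDominator →
    (GapBootstrap → FlatFarCertified → SwitchOffInward → AnchoredLocationP → LabelMatching →
      WeakCertificateAfterRelabelling) := by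
  intro hA hB hC hS1 hS2 hS3 hS4 hLM X _ _ _ _ D hD 𝒟 h𝒟 O d R₀ hO hc hf hdv _hgap hN
  -- label matching (v8: same number of holes, eventually non-negative excisions of the output)
  obtain ⟨d', R₀', hch, hNN, -, -, hc', hf', hdv', hanch, hnn⟩ := hLM X D hD 𝒟 h𝒟 O d R₀ hO hc hf hdv
  have hO' : O = exteriorOf 𝒟.toCauchyDevelopment d'.charted := by rw [hch]; exact hO
  have hA' := hA hS2 hS3
  -- per-hole data
  have key : ∀ i : Fin d'.N, ∃ (ρ' : ℝ → ℝ) (τm R₁ τ₁ τ₂ : ℝ) (W κ : ℝ → ℝ)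
      (Ψg : (d'.background i).domain → 𝒟.carrier) (P : ParityDatum (d'.motion i).1) (τn : ℝ)
      (Rc κ' : ℝ → ℝ)
      (Ψa : (boostedKerrBackground (relabelMotion P) (d'.motion i).2 (d'.mass i) (d'.spin i)).domain →
        𝒟.carrier),
      AdmissibleProfile d' R₀' i ρ' τm ∧ GapCert d' R₀' i (fun s ↦ 3 * (16 * ρ' s) + 2) R₁ τ₁ W Ψg ∧
        (τ₁ ≤ τ₂ ∧ Tendsto κ atTop (𝓝 0) ∧ Located d' i ρ' τ₁ W Ψg τ₂ κ (11 / 10) 46) ∧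
        SingleHoleCert d' R₀' i P ρ' τ₁ W Ψg τn Rc κ' Ψa := by
    intro i
    -- S4's kinematic majorant of hole `i` (the anchoring window of hole `i` of `d'` is non-degenerate)
    obtain ⟨Bk, hBk, hloc⟩ := hS4 X D hD 𝒟 h𝒟 O d' R₀' hO' hc' hf' hdv' hanch i (hnn i)
    -- the profile from (C)
    set γ : ℝ := ((d'.motion i).1 : E4 ≃L[ℝ] E4) (E4.basisVector 0) 0 with hγ
    have hγ0 : 0 < γ := (hc'.1 i).2.2
    obtain ⟨ρ', hsm, hmono, hconc, hsub, htop, hfloor, hder, hdom⟩ :=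
      hC (fun s ↦ max |Bk s| (d'.excision i s + 1)) (max 1 (R₀' + 2 + |d'.spin i|)) (1 / (4 * γ))
        (Location.tendsto_max_abs_add_one_div hBk (d'.tendsto_excision_div i)) (by positivity)
    have hone : ∀ s, 1 ≤ ρ' s := fun s ↦ (le_max_left _ _).trans (hfloor s)
    have hρpos : ∀ s, 0 < ρ' s := fun s ↦ one_pos.trans_le (hone s)
    have hdomBk : Tendsto (fun s ↦ Bk s / ρ' s) atTop (𝓝 0) := by
      refine squeeze_zero_norm' ?_ hdom
      filter_upwards with s
      rw [Real.norm_eq_abs, abs_div, abs_of_pos (hρpos s)]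
      exact div_le_div_of_nonneg_right (le_max_left _ _) (hρpos s).le
    obtain ⟨τm, hτm⟩ : ∃ τm, ∀ s, τm ≤ s → d'.excision i s + 1 ≤ ρ' s := by
      obtain ⟨τm, h⟩ := Filter.eventually_atTop.1 (hdom.eventually (gt_mem_nhds one_pos))
      refine ⟨τm, fun s hs ↦ ?_⟩
      have h1 := h s hs
      rw [div_lt_one (hρpos s)] at h1
      linarith [le_max_right |Bk s| (d'.excision i s + 1)]
    have hprof : AdmissibleProfile d' R₀' i ρ' τm := by
      refine ⟨hsm, hmono, hconc, hsub, htop, fun s ↦ ?_,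
        fun s ↦ ⟨(le_max_right _ _).trans (hfloor s), hone s⟩, hτm⟩
      have h1 := hder s
      rw [← hγ]
      calc 4 * γ * |deriv ρ' s| ≤ 4 * γ * (1 / (4 * γ)) :=
            mul_le_mul_of_nonneg_left h1 (by positivity)
        _ = 1 := by field_simp
    -- S1's gap certificate of `d'` at `i` for the majorant `16ρ'`
    have hmaj : ∀ s, τm ≤ s → d'.excision i s ≤ 16 * ρ' s := fun s hs ↦ by
      linarith [hτm s hs, hρpos s]
    have hsub16 : Tendsto (fun s ↦ 16 * ρ' s / s) atTop (𝓝 0) := by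
      simpa [mul_div_assoc] using hsub.const_mul 16
    obtain ⟨R₁, τ₁, W, Ψg, hG⟩ :=
      hS1 X D hD 𝒟 h𝒟 O d' R₀' hO' hc' hf' hdv' i (fun s ↦ 16 * ρ' s) τm hmaj hsub16
    obtain ⟨hR, hτ, hW, hwall, hG1, hG2, hG3, hG4, hG5⟩ := hG
    -- S4 five times
    have hS : ∀ ρ'' : ℝ → ℝ, Monotone ρ'' → Continuous ρ'' → ConcaveOn ℝ (Set.Ici 0) ρ'' →
        Tendsto (fun s ↦ ρ'' s / s) atTop (𝓝 0) → Tendsto (fun s ↦ Bk s / ρ'' s) atTop (𝓝 0) →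
        (∀ s, 1 ≤ ρ'' s) → (∀ s, τ₁ ≤ s → 3 * ρ'' s + 2 ≤ W s) →
        ∃ (τ₂ : ℝ) (κ : ℝ → ℝ), τ₁ ≤ τ₂ ∧ Tendsto κ atTop (𝓝 0) ∧
          Located d' i ρ'' τ₁ W Ψg τ₂ κ (11 / 10) (29 / 10) :=
      fun ρ'' h1 h2 h3 h4 h5 h6 hw ↦
        hloc ρ'' h1 h2 h3 h4 h5 h6 R₁ τ₁ W Ψg hR hτ hW hw hG1 hG2 hG3 hG4 hG5
    obtain ⟨τ₂, κ, hτ₂, hκ, hL⟩ := located_iterate d' i Bk hS 4 ρ' hmono hsm.continuous hconc hsub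
      hdomBk hone (fun s hs ↦ by have := hwall s hs; norm_num at this ⊢; linarith)
    have hL' : Located d' i ρ' τ₁ W Ψg τ₂ κ (11 / 10) 46 :=
      Located.weaken d' i hL (fun s ↦ (hρpos s).le) le_rfl (fun _ ↦ le_rfl) (by norm_num)
    -- (A)
    obtain ⟨P, τn, Rc, κ', Ψa, hshc⟩ := hA' _ O d' R₀' i ρ' τm R₁ τ₁ τ₂ W κ Ψg hc' hf' hdv' hprof
      ⟨hR, hτ, hW, hwall, hG1, hG2, hG3, hG4, hG5⟩ hτ₂ hκ hL'
    exact ⟨ρ', τm, R₁, τ₁, τ₂, W, κ, Ψg, P, τn, Rc, κ', Ψa, hprof,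
      ⟨hR, hτ, hW, hwall, hG1, hG2, hG3, hG4, hG5⟩, ⟨hτ₂, hκ, hL'⟩, hshc⟩
  choose ρ' τm R₁ τ₁ τ₂ W κ Ψg P τn Rc κ' Ψa hprof hgap hloc hshc using key
  -- the relabelled decomposition and (B)
  have hN' : 0 < d'.N := by rw [hNN]; exact hN
  refine ⟨relabelEach d' P, R₀', (Relabel.relabelEach_charted d' P).trans hch, hN',
    Relabel.honestCore_relabelEach d' P R₀' hc', flatTubesClosed_relabelEach d' P hf',
    Relabel.distinctLabels_relabelEach d' P hdv', ?_⟩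
  exact hB X D hD 𝒟 h𝒟 O d' R₀' hO' hc' hf' hdv' hanch hN' P ρ' τm R₁ τ₁ τ₂ τn W κ Rc κ' Ψg Ψa hprof
    hgap hloc hshc

end Summit.FinalStateConjecture.FinalStateConjecture.Theorems.GapDecaySuffices.Assembly

end
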